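import Summits.ABC.StewartYu.ArchG3RecLinesG
import HarnessLib

/-!
# The archimedean record `ArchG3Rec` — letter lines in closed form, file KFa: ATOMS OF THE (F) BUDGET LINE (k-steps, odd steps)

Support file (theorems only; no named facts). Cell `abc-stewartyu`, route `YuMatveevShapeRat`, crux r2 `ArchCoreRat`
(stmt-ABC-20502), line `arch-g3-frame`, stub `stub_recLinesArch`, R50: the (F) conjuncts of `KStepLinesK`/`OddStepLinesK`
(p1). The atoms of one step at `(lev, ν)`, in the unit `Z`, with `κ = 2^{n−1}`:
* `γb_Nf_le`: `γb lev·Nf lev (ν+1) ≤ 2^ν·(n/(16(n+1)) + 1/1000)·Z`;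
* `rhoF_facts`: the (F)-radius `ρF = (3e^G+1)(2Nf lev ν+1) + Nf lev ν` satisfies `0 ≤ ρF ≤ 2^{lev}·2^{n+6}·e^G·X ≤ 2^{Ŝ+n+6}·e^G·X`
  (`ν ≤ n`, `lev ≤ Ŝ`), in the shape `logWC_le`/`small_of_U0` consume; the odd-step radii `(12e^G+6)·Nh lev`, `6·Nh lev` likewise;
* `wl_rhoF_step_le`: `wl lev·ρF ≤ 2^ν·Z/40`; `wl_rhoO_le`: `wl lev·(12e^G+6)·Nh lev ≤ Z/25`;
(the denominators `cDR_le'` and the order costs `Tcost_step_le` are in file KFb).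

## References
* [Nesterenko2003] Yu. V. Nesterenko, LNM 1819 (2003) — §4.2 (4.24)–(4.35).
-/

noncomputable section

open Finset Real
open scoped Nat

namespace Summit.ABC.StewartYu

namespace ArchG3Rec

open PadicG3Par (Cb Cb_pos)
open ArchG3Par (G K yloadK G_eq G_pos K_pos yloadK_pos)

variable {n : ℕ} (P : ArchG3Rec n)

/-! ### The slab-centre term -/

set_option maxHeartbeats 400000 in
/-- **`γb lev·Nf lev (ν+1) ≤ 2^ν·(n/(16(n+1)) + 1/1000)·Z`** (`Nf lev (ν+1) = 2^{ν+1} Xs lev`, `γb·Xs ≤ (nL/2 + wl 0)(X/2+1)`,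
`n·X·L = n·Z/(8(n+1))`, `nL + 3·wl 0·X ≤ Z/1000`). [folklore] -/
theorem γb_Nf_le (lev ν : ℕ) : P.γb lev * P.Nf lev (ν + 1) ≤ 2 ^ ν * (((n : ℝ) / (16 * ((n : ℝ) + 1)) + 1 / 1000) * P.Z) := by
  obtain ⟨hγ, -, -, -, hγ0, -⟩ := P.γb_wl_Xs_le lev
  obtain ⟨hZ0, hZW, hZn, hXL⟩ := P.Z_floors
  obtain ⟨hwlX, hw0⟩ := P.wl_zero_X_le
  obtain ⟨e, hXs1⟩ := P.Nf_real lev (ν + 1)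
  have hX := P.X_floors.2.1
  have hL := P.L_real.2.1
  have hn1 : (1 : ℝ) ≤ n := by exact_mod_cast P.hn
  have hn0 : (0 : ℝ) ≤ n := by linarith
  rw [e, pow_succ]
  have h2 : (0 : ℝ) ≤ 2 ^ ν := by positivity
  -- `γb · (2^ν·2·Xs) = 2^ν · 2 · (γb·Xs) ≤ 2^ν · 2 (nL/2 + wl0)(X/2+1) = 2^ν (nL/2 + wl0)(X + 2)`
  have h1 : P.γb lev * (2 ^ ν * 2 * (P.Xs lev : ℝ)) = 2 ^ ν * (2 * (P.γb lev * P.Xs lev)) := by ring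
  rw [h1]
  apply mul_le_mul_of_nonneg_left _ h2
  -- `2 (nL/2 + wl0)(X/2 + 1) = n X L/2 + n L + wl0 X + 2 wl0 ≤ n Z/(16(n+1)) + Z/1000`
  have hq : (n : ℝ) * (P.X * P.L) / 2 = (n : ℝ) / (16 * ((n : ℝ) + 1)) * P.Z := by
    rw [hXL, G_eq]; field_simp; ring
  have hnL : (n : ℝ) * P.L ≤ P.Z / 1024 := by
    rw [le_div_iff₀ (by norm_num)]
    have h3 : (n : ℝ) * 1024 ≤ 512 * ((n : ℝ) + 1) ^ 2 := by nlinarith only [hn1]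
    have := mul_le_mul_of_nonneg_right h3 hL.le
    linarith only [this, hZn]
  have hw2 : 2 * P.wl 0 ≤ 2 * (P.wl 0 * P.X) := by
    have : P.wl 0 * 1 ≤ P.wl 0 * P.X := mul_le_mul_of_nonneg_left (by linarith) hw0.le
    linarith
  have e2 : 2 * (((n : ℝ) * P.L / 2 + P.wl 0) * (P.X / 2 + 1)) =
      (n : ℝ) * (P.X * P.L) / 2 + n * P.L + P.wl 0 * P.X + 2 * P.wl 0 := by ring
  linarith only [hγ, e2, hq, hnL, hw2, hwlX, hZ0]

/-! ### The radii -/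

set_option maxHeartbeats 400000 in
/-- **the (F)-radius of a k-step**: `ρF := (3e^G+1)(2·Nf lev ν + 1) + Nf lev ν` has `0 ≤ ρF`,
`ρF ≤ 2^{Ŝ−(Ŝ−lev)}·2^{n+6}·e^G·X` and `ρF ≤ 2^{Ŝ+n+6}·e^G·X` (`ν ≤ n`, `lev ≤ Ŝ`; `Nf ≤ 2^{ν+lev} X`, `13·2^ν ≤ 2^{n+6}`);
the same for the jets radius `3·Nf lev ν + 2`. [folklore] -/
theorem rhoF_facts (lev ν : ℕ) (hν : ν ≤ n) (hlev : lev ≤ P.Sd) :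
    0 ≤ (3 * Real.exp (G n) + 1) * (2 * (P.Nf lev ν : ℝ) + 1) + P.Nf lev ν ∧
    (3 * Real.exp (G n) + 1) * (2 * (P.Nf lev ν : ℝ) + 1) + P.Nf lev ν ≤ 2 ^ (P.Sd - (P.Sd - lev)) * (2 : ℝ) ^ (n + 6) * Real.exp (G n) * P.X ∧
    (3 * Real.exp (G n) + 1) * (2 * (P.Nf lev ν : ℝ) + 1) + P.Nf lev ν ≤ 2 ^ (P.Sd + n + 6) * Real.exp (G n) * P.X ∧
    (3 * (P.Nf lev ν : ℝ) + 2) ≤ 2 ^ (P.Sd - (P.Sd - lev)) * (2 : ℝ) ^ (n + 6) * Real.exp (G n) * P.X ∧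
    (3 * (P.Nf lev ν : ℝ) + 2) ≤ 2 ^ (P.Sd + n + 6) * Real.exp (G n) * P.X := by
  obtain ⟨-, hNf, -, -, -⟩ := P.nodes_le lev ν
  have hX := P.X_floors.2.1
  have hG := G_pos n
  have he1 : (1 : ℝ) ≤ Real.exp (G n) := Real.one_le_exp hG.le
  have hNf0 : (0 : ℝ) ≤ P.Nf lev ν := Nat.cast_nonneg _
  have hSl : P.Sd - (P.Sd - lev) = lev := by omega
  rw [hSl]
  -- `u := 2^{ν+lev} X ≥ 1`
  have hu1 : (1 : ℝ) ≤ 2 ^ (ν + lev) * P.X := by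
    have : (1 : ℝ) ≤ 2 ^ (ν + lev) := one_le_pow₀ (by norm_num)
    nlinarith
  have h13 : (3 * Real.exp (G n) + 1) * (2 * (P.Nf lev ν : ℝ) + 1) + P.Nf lev ν ≤ 13 * Real.exp (G n) * (2 ^ (ν + lev) * P.X) := by
    nlinarith
  have h5 : (3 * (P.Nf lev ν : ℝ) + 2) ≤ 13 * Real.exp (G n) * (2 ^ (ν + lev) * P.X) := by nlinarith
  -- `13·2^{ν+lev} ≤ 2^{lev}·2^{n+6}` and `2^lev ≤ 2^Ŝ`
  have hpow : 13 * (2 : ℝ) ^ (ν + lev) ≤ 2 ^ lev * 2 ^ (n + 6) := by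
    have h13 : 13 * (2 : ℝ) ^ ν ≤ 2 ^ (n + 6) := by
      have hνn : (2 : ℝ) ^ ν ≤ 2 ^ n := pow_le_pow_right₀ (by norm_num) hν
      have h2n : (0 : ℝ) < 2 ^ n := by positivity
      rw [pow_add]; norm_num; linarith
    have h2l : (0 : ℝ) ≤ 2 ^ lev := by positivity
    rw [pow_add]
    calc 13 * ((2 : ℝ) ^ ν * 2 ^ lev) = (13 * 2 ^ ν) * 2 ^ lev := by ring
      _ ≤ 2 ^ (n + 6) * 2 ^ lev := mul_le_mul_of_nonneg_right h13 h2l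
      _ = 2 ^ lev * 2 ^ (n + 6) := by ring
  have hpow2 : (2 : ℝ) ^ lev * 2 ^ (n + 6) ≤ 2 ^ (P.Sd + n + 6) := by
    rw [← pow_add]; exact pow_le_pow_right₀ (by norm_num) (by omega)
  have hEX : (0 : ℝ) ≤ Real.exp (G n) * P.X := by positivity
  have hA : 13 * Real.exp (G n) * (2 ^ (ν + lev) * P.X) ≤ 2 ^ lev * (2 : ℝ) ^ (n + 6) * Real.exp (G n) * P.X := by
    have := mul_le_mul_of_nonneg_right hpow hEX; linarith
  have hB : 2 ^ lev * (2 : ℝ) ^ (n + 6) * Real.exp (G n) * P.X ≤ 2 ^ (P.Sd + n + 6) * Real.exp (G n) * P.X := by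
    have := mul_le_mul_of_nonneg_right hpow2 hEX; linarith
  refine ⟨by positivity, h13.trans hA, (h13.trans hA).trans hB, h5.trans hA, (h5.trans hA).trans hB⟩

set_option maxHeartbeats 400000 in
/-- **the odd-step radii**: `(12e^G+6)·Nh lev` and `6·Nh lev` are `≥ 0` and `≤ 2^{Ŝ−(Ŝ−lev)}·2^{n+6}·e^G·X ≤ 2^{Ŝ+n+6}·e^G·X`. [folklore] -/
theorem rhoO_facts (lev : ℕ) (hlev : lev ≤ P.Sd) :
    0 ≤ (12 * Real.exp (G n) + 6) * (P.Nh lev : ℝ) ∧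
    (12 * Real.exp (G n) + 6) * (P.Nh lev : ℝ) ≤ 2 ^ (P.Sd - (P.Sd - lev)) * (2 : ℝ) ^ (n + 6) * Real.exp (G n) * P.X ∧
    (12 * Real.exp (G n) + 6) * (P.Nh lev : ℝ) ≤ 2 ^ (P.Sd + n + 6) * Real.exp (G n) * P.X ∧
    (6 * (P.Nh lev : ℝ)) ≤ 2 ^ (P.Sd - (P.Sd - lev)) * (2 : ℝ) ^ (n + 6) * Real.exp (G n) * P.X ∧
    (6 * (P.Nh lev : ℝ)) ≤ 2 ^ (P.Sd + n + 6) * Real.exp (G n) * P.X := by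
  obtain ⟨-, -, hNh, -, -⟩ := P.nodes_le lev 0
  have hX := P.X_floors.2.1
  have hG := G_pos n
  have he1 : (1 : ℝ) ≤ Real.exp (G n) := Real.one_le_exp hG.le
  have hNh0 : (0 : ℝ) ≤ P.Nh lev := Nat.cast_nonneg _
  have hSl : P.Sd - (P.Sd - lev) = lev := by omega
  rw [hSl]
  have h18 : (12 * Real.exp (G n) + 6) * (P.Nh lev : ℝ) ≤ 18 * Real.exp (G n) * (2 ^ lev * P.X) := by nlinarith
  have h6 : 6 * (P.Nh lev : ℝ) ≤ 18 * Real.exp (G n) * (2 ^ lev * P.X) := by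
    have : (0 : ℝ) ≤ 2 ^ lev * P.X := by positivity
    nlinarith
  have hpow : (18 : ℝ) ≤ 2 ^ (n + 6) := le_trans (by norm_num) (pow_le_pow_right₀ (by norm_num) (by omega : 6 ≤ n + 6))
  have hA : 18 * Real.exp (G n) * (2 ^ lev * P.X) ≤ 2 ^ lev * (2 : ℝ) ^ (n + 6) * Real.exp (G n) * P.X := by
    have h0 : (0 : ℝ) ≤ 2 ^ lev * Real.exp (G n) * P.X := by positivity
    nlinarith [mul_le_mul_of_nonneg_right hpow h0]
  have hpow2 : (2 : ℝ) ^ lev * 2 ^ (n + 6) ≤ 2 ^ (P.Sd + n + 6) := by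
    rw [← pow_add]; exact pow_le_pow_right₀ (by norm_num) (by omega)
  have hB : 2 ^ lev * (2 : ℝ) ^ (n + 6) * Real.exp (G n) * P.X ≤ 2 ^ (P.Sd + n + 6) * Real.exp (G n) * P.X := by
    have := mul_le_mul_of_nonneg_right hpow2 (show (0 : ℝ) ≤ Real.exp (G n) * P.X by positivity); linarith
  refine ⟨by positivity, h18.trans hA, (h18.trans hA).trans hB, h6.trans hA, (h6.trans hA).trans hB⟩

/-! ### The width terms -/

set_option maxHeartbeats 400000 in
/-- `e^{-2} ≤ 0.1354` and `wl 0 = L·e^{−(G+2)}`, `(3e^G + 1)·wl lev·Xs lev ≤ (3e^{−2}·L + wl 0)·(X/2 + 1)`. [folklore] -/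
theorem wl_exp_facts (lev : ℕ) : Real.exp (-2 : ℝ) ≤ 0.1354 ∧
    (3 * Real.exp (G n) + 1) * (P.wl lev * P.Xs lev) ≤ (3 * Real.exp (-2 : ℝ) * P.L + P.wl 0) * (P.X / 2 + 1) ∧
    Real.exp (G n) * P.wl lev ≤ Real.exp (-2 : ℝ) * P.L := by
  obtain ⟨-, hB, -, hD, -, hwl⟩ := P.γb_wl_Xs_le lev
  have hw0 := (P.wl_facts 0).2
  have hX : (0 : ℝ) ≤ P.X := Nat.cast_nonneg _
  have hL : (0 : ℝ) ≤ P.L := Nat.cast_nonneg _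
  have he2 : Real.exp (-2 : ℝ) ≤ 0.1354 := by
    rw [Real.exp_neg, inv_le_comm₀ (Real.exp_pos _) (by norm_num)]
    have h := Real.exp_one_gt_d9
    have : Real.exp 2 = Real.exp 1 ^ 2 := by rw [← Real.exp_nat_mul]; norm_num
    rw [this]; nlinarith
  -- `e^G · wl lev ≤ e^G · wl 0 = L e^{-2}`
  have hGw : Real.exp (G n) * P.wl 0 = Real.exp (-2 : ℝ) * P.L := by
    unfold wl; simp only [pow_zero, div_one]
    rw [show -(G n + 2) = -2 + -G n by ring, Real.exp_add]
    have : Real.exp (G n) * Real.exp (-G n) = 1 := by rw [← Real.exp_add]; simp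
    calc Real.exp (G n) * (P.L * (Real.exp (-2) * Real.exp (-G n)))
        = P.L * Real.exp (-2) * (Real.exp (G n) * Real.exp (-G n)) := by ring
      _ = Real.exp (-2 : ℝ) * P.L := by rw [this]; ring
  have hGwl : Real.exp (G n) * P.wl lev ≤ Real.exp (-2 : ℝ) * P.L := by
    rw [← hGw]; exact mul_le_mul_of_nonneg_left hD (Real.exp_pos _).le
  refine ⟨he2, ?_, hGwl⟩
  -- `(3e^G + 1) wl Xs = 3 e^G wl Xs + wl Xs ≤ 3 e^{-2} L (X/2+1)·(Xs-normalised)…`: use `wl·Xs ≤ wl0 (X/2+1)` and `e^G wl = e^{-2}L·(wl lev/wl 0)`…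
  -- simpler: `e^G · (wl lev · Xs lev) ≤ e^G · wl 0 (X/2+1) · …`? No: use `wl lev Xs lev ≤ wl 0 (X/2+1)` and `e^G wl 0 = e^{-2} L`.
  have hXs0 : (0 : ℝ) ≤ P.Xs lev := Nat.cast_nonneg _
  have h1 : Real.exp (G n) * (P.wl lev * P.Xs lev) ≤ Real.exp (G n) * (P.wl 0 * (P.X / 2 + 1)) :=
    mul_le_mul_of_nonneg_left hB (Real.exp_pos _).le
  have e1 : Real.exp (G n) * (P.wl 0 * (P.X / 2 + 1)) = Real.exp (-2 : ℝ) * P.L * (P.X / 2 + 1) := by rw [← hGw]; ring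
  nlinarith

set_option maxHeartbeats 400000 in
/-- **`wl lev·ρF ≤ 2^ν·Z/40`** for the (F)-radius `ρF = (3e^G+1)(2Nf lev ν+1) + Nf lev ν` (`n ≥ 2`). [folklore] -/
theorem wl_rhoF_step_le (hn2 : 2 ≤ n) (lev ν : ℕ) :
    P.wl lev * ((3 * Real.exp (G n) + 1) * (2 * (P.Nf lev ν : ℝ) + 1) + P.Nf lev ν) ≤ 2 ^ ν * (P.Z / 40) := by
  obtain ⟨he2, hA, hGwl⟩ := P.wl_exp_facts lev
  obtain ⟨-, hB, -, hD, -, hwl⟩ := P.γb_wl_Xs_le lev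
  obtain ⟨hZ0, hZW, hZn, hXL⟩ := P.Z_floors
  obtain ⟨hwlX, hw0⟩ := P.wl_zero_X_le
  obtain ⟨e, hXs1⟩ := P.Nf_real lev ν
  have hX := P.X_floors.2.1
  have hL := P.L_real.2.1
  have hn : (2 : ℝ) ≤ n := by exact_mod_cast hn2
  have h2 : (1 : ℝ) ≤ 2 ^ ν := one_le_pow₀ (by norm_num)
  have h20 : (0 : ℝ) ≤ 2 ^ ν := by positivity
  rw [e]
  -- expand: `wl·((3e^G+1)(2·2^ν Xs + 1) + 2^ν Xs) = 2^ν·2·(3e^G+1)(wl Xs) + (3e^G+1) wl + 2^ν (wl Xs)`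
  have e1 : P.wl lev * ((3 * Real.exp (G n) + 1) * (2 * (2 ^ ν * (P.Xs lev : ℝ)) + 1) + 2 ^ ν * P.Xs lev) =
      2 ^ ν * (2 * ((3 * Real.exp (G n) + 1) * (P.wl lev * P.Xs lev)) + P.wl lev * P.Xs lev) +
        (3 * (Real.exp (G n) * P.wl lev) + P.wl lev) := by ring
  rw [e1]
  -- `X·L ≤ Z/24`, `L ≤ Z/4608`, `wl0·X ≤ Z/2^18`, `wl 0 ≤ Z/2^25`
  have hXL' : (P.X : ℝ) * P.L ≤ P.Z / 24 := by
    rw [hXL, G_eq]; apply div_le_div_of_nonneg_left hZ0.le (by norm_num); linarith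
  have hL' : (P.L : ℝ) ≤ P.Z / 4608 := by
    rw [le_div_iff₀ (by norm_num)]
    have h9 : (9 : ℝ) ≤ ((n : ℝ) + 1) ^ 2 := by nlinarith only [hn]
    have := mul_le_mul_of_nonneg_right h9 (show (0 : ℝ) ≤ 512 * P.L by positivity)
    nlinarith only [this, hZn]
  have hw0' : P.wl 0 ≤ P.Z / 2 ^ 25 := by
    have : P.wl 0 * 128 ≤ P.wl 0 * P.X := mul_le_mul_of_nonneg_left hX hw0.le
    linarith
  have he0 : 0 ≤ Real.exp (-2 : ℝ) := (Real.exp_pos _).le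
  have hXL0 : (0 : ℝ) ≤ P.X * P.L := by positivity
  have p1 : Real.exp (-2 : ℝ) * (P.X * P.L) ≤ 0.1354 * (P.Z / 24) := mul_le_mul he2 hXL' hXL0 (by norm_num)
  have p2 : Real.exp (-2 : ℝ) * P.L ≤ 0.1354 * (P.Z / 4608) := mul_le_mul he2 hL' hL.le (by norm_num)
  have eA : (3 * Real.exp (-2 : ℝ) * P.L + P.wl 0) * (P.X / 2 + 1) =
      3 / 2 * (Real.exp (-2 : ℝ) * (P.X * P.L)) + 3 * (Real.exp (-2 : ℝ) * P.L) + P.wl 0 * P.X / 2 + P.wl 0 := by ring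
  have eB : P.wl 0 * ((P.X : ℝ) / 2 + 1) = P.wl 0 * P.X / 2 + P.wl 0 := by ring
  have hbr : 2 * ((3 * Real.exp (G n) + 1) * (P.wl lev * P.Xs lev)) + P.wl lev * P.Xs lev + (3 * Real.exp (-2 : ℝ) * P.L + P.wl 0) ≤
      P.Z / 40 := by
    linarith only [hA, hB, eA, eB, p1, p2, hw0', hwlX, hZ0]
  have hgrp0 : 0 ≤ 3 * (Real.exp (G n) * P.wl lev) + P.wl lev := by positivity
  have hgrp2' : 3 * (Real.exp (G n) * P.wl lev) + P.wl lev ≤ 2 ^ ν * (3 * (Real.exp (G n) * P.wl lev) + P.wl lev) := by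
    have := mul_le_mul_of_nonneg_right h2 hgrp0; linarith
  have key : 2 ^ ν * (2 * ((3 * Real.exp (G n) + 1) * (P.wl lev * P.Xs lev)) + P.wl lev * P.Xs lev) +
      2 ^ ν * (3 * (Real.exp (G n) * P.wl lev) + P.wl lev) ≤ 2 ^ ν * (P.Z / 40) := by
    rw [← mul_add]
    apply mul_le_mul_of_nonneg_left _ h20
    have : 3 * (Real.exp (G n) * P.wl lev) + P.wl lev ≤ 3 * Real.exp (-2 : ℝ) * P.L + P.wl 0 := by linarith
    linarith
  linarith only [key, hgrp2']

set_option maxHeartbeats 400000 in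
/-- **`wl lev·(12e^G+6)·Nh lev ≤ Z/25`** (odd step; `e^G wl ≤ e^{-2} L`, `XL = Z/(8(n+1))`, `n ≥ 2`). [folklore] -/
theorem wl_rhoO_le (hn2 : 2 ≤ n) (lev : ℕ) : P.wl lev * ((12 * Real.exp (G n) + 6) * (P.Nh lev : ℝ)) ≤ P.Z / 25 := by
  obtain ⟨he2, hA, hGwl⟩ := P.wl_exp_facts lev
  obtain ⟨-, hB, -, hD, -, hwl⟩ := P.γb_wl_Xs_le lev
  obtain ⟨hZ0, hZW, hZn, hXL⟩ := P.Z_floors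
  obtain ⟨hwlX, hw0⟩ := P.wl_zero_X_le
  have hX := P.X_floors.2.1
  have hL := P.L_real.2.1
  have hn : (2 : ℝ) ≤ n := by exact_mod_cast hn2
  unfold Nh
  have e1 : P.wl lev * ((12 * Real.exp (G n) + 6) * (P.Xs lev : ℝ)) =
      4 * ((3 * Real.exp (G n) + 1) * (P.wl lev * P.Xs lev)) + 2 * (P.wl lev * P.Xs lev) := by ring
  rw [e1]
  have hXL' : (P.X : ℝ) * P.L ≤ P.Z / 24 := by
    rw [hXL, G_eq]; apply div_le_div_of_nonneg_left hZ0.le (by norm_num); linarith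
  have hL' : (P.L : ℝ) ≤ P.Z / 4608 := by
    rw [le_div_iff₀ (by norm_num)]
    have h9 : (9 : ℝ) ≤ ((n : ℝ) + 1) ^ 2 := by nlinarith only [hn]
    have := mul_le_mul_of_nonneg_right h9 (show (0 : ℝ) ≤ 512 * P.L by positivity)
    nlinarith only [this, hZn]
  have hw0' : P.wl 0 ≤ P.Z / 2 ^ 25 := by
    have : P.wl 0 * 128 ≤ P.wl 0 * P.X := mul_le_mul_of_nonneg_left hX hw0.le
    linarith
  have he0 : 0 ≤ Real.exp (-2 : ℝ) := (Real.exp_pos _).le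
  have hXL0 : (0 : ℝ) ≤ P.X * P.L := by positivity
  have p1 : Real.exp (-2 : ℝ) * (P.X * P.L) ≤ 0.1354 * (P.Z / 24) := mul_le_mul he2 hXL' hXL0 (by norm_num)
  have p2 : Real.exp (-2 : ℝ) * P.L ≤ 0.1354 * (P.Z / 4608) := mul_le_mul he2 hL' hL.le (by norm_num)
  have eA : (3 * Real.exp (-2 : ℝ) * P.L + P.wl 0) * (P.X / 2 + 1) =
      3 / 2 * (Real.exp (-2 : ℝ) * (P.X * P.L)) + 3 * (Real.exp (-2 : ℝ) * P.L) + P.wl 0 * P.X / 2 + P.wl 0 := by ring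
  have eB : P.wl 0 * ((P.X : ℝ) / 2 + 1) = P.wl 0 * P.X / 2 + P.wl 0 := by ring
  linarith only [hA, hB, eA, eB, p1, p2, hw0', hwlX, hZ0]

end ArchG3Rec

end Summit.ABC.StewartYu
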